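import Mathlib
import Summits.Ventures.PercRepro.TriangleCapStarStability

/-!
# PercRepro — THE SECOND-BEST VALUE OF THE CLOSED FORM, THE OTHER BIPARTITION: on a cell `(k, a, r)` with
`r < a` and `k ≥ 2a + 2` the graph `K_{a+1,k−a−1}` minus a star is `2 (k − 2a − 1)(a − r)` below the closed form
(p3, gen 42; part 185)

Part 184 bounds the second-best value of the closed form on the bipartite class with the parts `a, k − a`
(`2 (r − 2)` below for `r ≥ 3`, `2` below for `r = 2`).  The OTHER bipartition competes: `K_{a+1,k−a−1}` has
`a(k−a) + (k − 2a − 1)` edges, so minus a star of `r' = r + (k − 2a − 1)` edges at one vertex it sits on the cell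
`(k, a, r)` with `Σ_v d(v)² = m k − r (k − 1 − r) − 2 (k − 2a − 1)(a − r)` (`other_bipartition_value`): the
closed form's slack is `2 (k − 2a − 1)(a − r)`, which is smaller than `2 (r − 2)` when `r` is close to `a` (for
instance `k = 2a + 2`, `r = a − 1`: slack `2`).  The graph is `bipMinusStar k (a + 1) r'` (part 140), `K₄⁻`-free
with `a(k−a) − r` edges.  Axioms: standard.
-/

namespace PercRepro

namespace TriangleCap

namespace C047

open Finset

/-- **THE OTHER BIPARTITION ON THE CELL `(k, a, r)`:** for `r < a` and `k ≥ 2a + 2`, `K_{a+1,k−a−1}` minus a star of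
`r + (k − 2a − 1)` edges is a `K₄⁻`-free graph on `Fin k` with `a(k−a) − r` edges and
`Σ_v d(v)² + r (k − 1 − r) + 2 (k − 2a − 1)(a − r) = m k`. -/
theorem other_bipartition_value (k a r : ℕ) (ha : 1 ≤ a) (hr : r < a) (hk : 2 * a + 2 ≤ k) :
    ∃ (D : SimpleGraph (Fin k)) (_ : DecidableRel D.Adj), K4mFree D ∧
      D.edgeFinset.card = a * (k - a) - r ∧
      ∑ v, deg D v * deg D v + r * (k - 1 - r) + 2 * (k - 2 * a - 1) * (a - r) = (a * (k - a) - r) * k := by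
  obtain ⟨c, rfl⟩ : ∃ c, k = 2 * a + 2 + c := ⟨k - (2 * a + 2), by omega⟩
  obtain ⟨d, rfl⟩ : ∃ d, a = r + 1 + d := ⟨a - (r + 1), by omega⟩
  -- the other bipartition `a' = a + 1 = r + d + 2`, the star `r' = r + c + 1`
  have e1 : 2 * (r + 1 + d) + 2 + c - (r + 1 + d + 1) = r + d + 2 + c := by omega
  have e2 : 2 * (r + 1 + d) + 2 + c - (r + 1 + d) = r + d + 3 + c := by omega
  have e3 : 2 * (r + 1 + d) + 2 + c - 1 - r = r + 2 * d + 3 + c := by omega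
  have e4 : 2 * (r + 1 + d) + 2 + c - 2 * (r + 1 + d) - 1 = c + 1 := by omega
  have e5 : r + 1 + d - r = d + 1 := by omega
  have e6 : 2 * (2 * (r + 1 + d) + 2 + c) - (r + c + 1) - 3 = 3 * r + 4 * d + 4 + c := by omega
  have e7 : 2 * (r + 1 + d) + 2 + c - 2 = 2 * r + 2 * d + 2 + c := by omega
  have hprod : (r + 1 + d + 1) * (r + d + 2 + c) = (r + 1 + d) * (r + d + 3 + c) + (c + 1) := by ring
  have h1 := two_mul_cherries_bipMinusStar (2 * (r + 1 + d) + 2 + c) (r + 1 + d + 1) (r + c + 1) (by omega)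
    (by omega) (by omega)
  have h2 := card_edges_bipMinusStar (2 * (r + 1 + d) + 2 + c) (r + 1 + d + 1) (r + c + 1) (by omega) (by omega)
  have h3 := two_mul_cherries_add (bipMinusStar (2 * (r + 1 + d) + 2 + c) (r + 1 + d + 1) (r + c + 1))
  have h4 := sum_deg_eq (bipMinusStar (2 * (r + 1 + d) + 2 + c) (r + 1 + d + 1) (r + c + 1))
  rw [e1, e6, e7] at h1
  rw [e1] at h2
  generalize hC : cherries (bipMinusStar (2 * (r + 1 + d) + 2 + c) (r + 1 + d + 1) (r + c + 1)) = C at h1 h3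
  generalize hM : (bipMinusStar (2 * (r + 1 + d) + 2 + c) (r + 1 + d + 1) (r + c + 1)).edgeFinset.card = M
    at h2 h3 h4
  generalize hS : ∑ v, deg (bipMinusStar (2 * (r + 1 + d) + 2 + c) (r + 1 + d + 1) (r + c + 1)) v *
    deg (bipMinusStar (2 * (r + 1 + d) + 2 + c) (r + 1 + d + 1) (r + c + 1)) v = S at h3
  have hMeq : M + r = (r + 1 + d) * (r + d + 3 + c) := by omega
  refine ⟨bipMinusStar (2 * (r + 1 + d) + 2 + c) (r + 1 + d + 1) (r + c + 1), inferInstance,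
    k4mFree_bipMinusStar _ _ _, ?_, ?_⟩
  · rw [hM, e2]
    omega
  · rw [hS, e2, e3, e4, e5]
    have hMe : (r + 1 + d) * (r + d + 3 + c) - r = M := by omega
    rw [hMe]
    rw [h4] at h3
    zify at h1 h3 hMeq ⊢
    linear_combination h1 - h3 + (2 - (2 * ((r : ℤ) + 1 + d) + 2 + c)) * hMeq

end C047

end TriangleCap

end PercRepro
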